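import Literature.NumberTheory.EllipticCurves.BigGaloisRepSelmer
import Summits.BirchSwinnertonDyer.Rank1Residual.X11b.SelmerTorsionControl
import Summits.BirchSwinnertonDyer.Rank1Residual.X11b.PontryaginCongruence
import Summits.BirchSwinnertonDyer.BirchSwinnertonDyer.Theorems.ErratumRoadFiveSelmerTorsionControlFinite
import HarnessLib

/-!
# Crux 4 `BSDpOnCellC` (stmt-BirchSwinnertonDyer-19034), line `telescope`, research node K2 (`stub_carrierDivInt` of v6 /
# `K2Mod.stub_branchFibreDiv` of `Cruxes/BSDpOnCellC/Lines/telescopeK2module.lean`): WEIGHT-VARIABLE CONTROL OF THE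
# TWO-VARIABLE SELMER STRUCTURE WITH FINITE DEFECT ON BOTH SIDES — exact case in Pontryagin-dual form, finite global defect,
# two-sided finite control (Selmer side). Helper, `--supports stmt-BirchSwinnertonDyer-19034 --as helper`; closes nothing.

Ideator `bsd-idea-12` g34 (planner). A Theorems PORT, by name, of §1/§3/§4 of the critic-passed workfile
`Cruxes/BSDpOnCellC/K2ClassicalSketch.lean` v1.4 (idea card `Cruxes/BSDpOnCellC/Ideas/k2-classical.md`, critic `idea-crit-14`
V176/V187/V193 PASS), so that the K2 leaves (`Cruxes/BSDpOnCellC/Lines/telescopeK2leaves.lean`) and any v7 of the LEAD's skeleton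
can cite these lemmas BY NAME (LEAD `cruxlead-19034` g1 HANDOFF-FINAL NEXT (0)(a′)). Theorems only: no definition, no named fact,
no `sorry`, no instance, no notation. Statements and proofs are those of the sketch, unchanged; only the namespace moved.
Companion file (pure module algebra, §2/§5/§6 of the sketch): `Theorems/EisensteinPrimesBSDpOnCellCTelescopeK2ControlAlgebra.lean`.

## What is proved (all unconditional; binders only)

* `quotXBig_equiv_dual_selmer_torsion` — for ANY coefficient ring `𝒪₂`, any discrete `𝒪₂`-linear `ρ₂` on `A₂`, any
  `r ∈ Λ₂ = PowerSeries 𝒪₂` acting surjectively on `M₂ = A₂ ⊗ Λ^*(Ψ⁻¹)` (`AnticyclotomicBigGaloisRep κ ρ₂`) with `r`-divisible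
  global and constrained-local invariants: `X₂ ⧸ r X₂ ≃ₗ[Λ₂] Sel(M₂[r])^∨`, `X₂ = XBig κ ρ₂ 𝔮 Σ` — the tree's erratum-Lemma-2.1
  control (`TorsionControl.selmerTorsionEquiv`) composed with the tree's Pontryagin step
  (`PontryaginCongruence.nonempty_quotSMulTop_equiv_dual_torsionBy`), to be read at a WEIGHT specialisation `r = X′ − x_k`
  (a constant of `Λ₂ = 𝒪₂⟦T⟧`, `𝒪₂ = ℤ_p⟦X′⟧` the disc chart of a Hida branch) instead of `ϖ^m` / `T_c` (EXACT case).
* `finite_ker_torsionInclH1_of_finite_quot` — for an `r`-divisible discrete `Γ`-module `M`: the GLOBAL control defect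
  `ker (H¹(Γ, M[r]) → H¹(Γ, M)) = δ₀(M^Γ)` is finite as soon as `M^Γ ⧸ r·M^Γ` is (replaces the divisibility hypothesis (glob) of
  the exact case, which fails on cell C: rational `p`-torsion).
* `twoSided_finite_control` — the control map `θ_r : Sel(M[r]) → Sel(M)[r]` has FINITE KERNEL (previous item) AND FINITE
  COKERNEL (the tree's `ErratumThm23TwoVariable.SelmerFiniteDefect.finite_selmer_torsion_quot`) when the global invariants and
  the constrained local invariants at finitely many `v ∈ L₀` have finite `r`-cotorsion and the other constrained local invariants
  are `r`-divisible: neither (glob) nor (dec) assumed.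

Where it is consumed: clauses (ctrl_k)/(reg_k) of `K2Mod.stub_branchFibreDiv` (member control with finite two-sided defect
feeding `charIdeal`-divisibilities through `RetractionSpecialization`) and the D-0171 leaves N2/N3 of `Lines/telescopeK2leaves.lean`.

HONEST FRAMING: Selmer-structure algebra over binders; nothing about any curve, newform or `L`-function is asserted; the branch
lattice `ρ₂` is a binder, not constructed; BSD is proved for no pair; no summit statement is proved by this file; closes: none.

## References
* [Castella2018Erratum] Lemma 2.1 (p. 2); [JetchevSkinnerWan2017] §3.4, Lemma 3.4.1 (arXiv:1512.06894 p. 14).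
* [Delbourgo2008] App. C (P. Smith), Thm. C.15 (weight-variable control); [GreenbergLNM1716] §4, proof of Prop. 4.10.
-/

noncomputable section

-- D-0017: single-problem summit, the namespace repeats the problem name by design.
set_option linter.dupNamespace false
set_option autoImplicit false

open CategoryTheory Field IsDedekindDomain NumberField
open Literature.NumberTheory.GaloisRepresentations Literature.NumberTheory.EllipticCurves
open Literature.NumberTheory.EllipticCurves.BigGaloisRep
open Summit.BirchSwinnertonDyer.Rank1Residual.X11b
open scoped ContRepresentation Pointwise

universe u

namespace Summit.BirchSwinnertonDyer.BirchSwinnertonDyer.Theorems.TelescopeK2WeightControl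

/-! ## §A Exact weight-variable control in Pontryagin-dual form -/

section Control

variable {K : Type u} [Field K] [NumberField K] {p : ℕ} [Fact p.Prime]
  {𝒪₂ : Type*} [CommRing 𝒪₂] [TopologicalSpace 𝒪₂]
  {A₂ : Type u} [AddCommGroup A₂] [Module 𝒪₂ A₂] [TopologicalSpace A₂] [DiscreteTopology A₂]
  [TopologicalSpace (PowerSeries 𝒪₂)] [ContinuousSMul (PowerSeries 𝒪₂) (BigRepModule 𝒪₂ p A₂)]

/-- **`X₂ ⧸ r·X₂ ≃ Sel(M₂[r])^∨`** for `X₂ = XBig κ ρ₂ 𝔮 Σ = Sel^Σ_𝔮(K, M₂)^∨`, `M₂ = A₂ ⊗ Λ^*(Ψ⁻¹)`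
(`AnticyclotomicBigGaloisRep κ ρ₂`), and ANY `r ∈ Λ₂ = 𝒪₂⟦T⟧` acting surjectively on `M₂` whose global
invariants `M₂^{Γ_K}` and constrained local invariants `M₂^{Γ_v}` (`v ∈ strictSet p 𝔮 Σ`) are `r`-divisible
(the EXACT case: no control defect). Intended reading: `𝒪₂ = R₀⟦X′⟧` the disc chart of the Hida branch through
`f_E`, `ρ₂` the self-dual branch lattice `𝐓† ⊗ 𝒪₂^∨`, `r = C(X′ − x_k)` the weight-`k` specialisation, so that
`M₂[r]` is the member's big representation and the right-hand side is the member's `X`.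
[cite: Castella2018Erratum, Lemma 2.1 (p. 2)] [cite: JetchevSkinnerWan2017, Lemma 3.4.1 (arXiv:1512.06894 p. 14)]
[cite: Delbourgo2008, App. C (P. Smith), Thm. C.15 (p. 362 of the CUP PDF; weight-variable control)] -/
theorem quotXBig_equiv_dual_selmer_torsion (κ : ZpExtension K p)
    (ρ₂ : ContinuousRep (absoluteGaloisGroup K) 𝒪₂ A₂)
    (𝔮 : HeightOneSpectrum (𝓞 K)) (S : Set (HeightOneSpectrum (𝓞 K))) (r : PowerSeries 𝒪₂)
    (hr : Function.Surjective fun m : BigRepModule 𝒪₂ p A₂ => r • m)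
    (hglob : ∀ w ∈ (AnticyclotomicBigGaloisRep κ ρ₂).toTopRep.ρ.invariants,
      ∃ w' ∈ (AnticyclotomicBigGaloisRep κ ρ₂).toTopRep.ρ.invariants, r • w' = w)
    (hloc : ∀ v ∈ strictSet p 𝔮 S,
      ∀ w ∈ (((AnticyclotomicBigGaloisRep κ ρ₂).restrict (localMap K v)).toTopRep).ρ.invariants,
        ∃ w' ∈ (((AnticyclotomicBigGaloisRep κ ρ₂).restrict (localMap K v)).toTopRep).ρ.invariants,
          r • w' = w) :
    Nonempty ((XBig κ ρ₂ 𝔮 S ⧸ r • (⊤ : Submodule (PowerSeries 𝒪₂) (XBig κ ρ₂ 𝔮 S))) ≃ₗ[PowerSeries 𝒪₂]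
      CharacterModule (TorsionControl.selmer (localMap K) (strictSet p 𝔮 S)
        (TorsionControl.torsionRep (AnticyclotomicBigGaloisRep κ ρ₂) r))) := by
  obtain ⟨e₁⟩ := PontryaginCongruence.nonempty_quotSMulTop_equiv_dual_torsionBy
    (R := PowerSeries 𝒪₂) (S := selmerBig κ ρ₂ 𝔮 S) r
  let e₂ := TorsionControl.selmerTorsionEquiv (localMap K) (strictSet p 𝔮 S)
    (AnticyclotomicBigGaloisRep κ ρ₂) r hr hglob hloc
  exact ⟨e₁.trans (CharacterModule.congr e₂).symm⟩

end Control

/-! ## §B The GLOBAL control defect `ker H¹(ι_r) = δ₀(M^Γ)` is a quotient of `M^Γ ⧸ r·M^Γ`, hence finite -/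

section GlobalDefect

variable {A : Type*} [CommRing A] [TopologicalSpace A]
variable {Γ : Type u} [Group Γ] [TopologicalSpace Γ] [IsTopologicalGroup Γ]
variable {M : Type u} [AddCommGroup M] [Module A M] [TopologicalSpace M] [DiscreteTopology M]
  [ContinuousSMul A M]

/-- **Finite global defect.** For an `r`-divisible discrete `Γ`-module `M` over `A`: if `M^Γ ⧸ r·M^Γ` is finite
then `ker (H¹(ι) : H¹(Γ, M[r]) → H¹(Γ, M))` is finite — it equals `δ₀(M^Γ)` (tree
`TorsionControl.cohomologyMap_torsionIncl_eq_zero_iff`) and `δ₀` kills `r·M^Γ` (tree `IsSES.δ₀_eq_zero_iff`; the LOCAL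
twin of this step is the tree's `SelmerFiniteDefect.smul_top_le_ker_δ₀` / `finite_range_δ₀`, whose argument is reused). This
replaces the template's hypothesis (glob) «`M^{Γ_K}` has no `p`-torsion» (FALSE on cell C: rational `p`-torsion) by
«the global defect is finite for every member»; combined with §2 its input is the finiteness of the member's global
invariants (`E(K^{ac}_∞)[p^∞]` finite at `k = 2`). [cite: Castella2018Erratum, Lemma 2.1 (proof)] [folklore] -/
theorem finite_ker_torsionInclH1_of_finite_quot (ρ : ContinuousRep Γ A M) (r : A)
    (hr : Function.Surjective fun m : M => r • m)
    (hfin : Finite (↥ρ.toTopRep.ρ.invariants ⧸ r • (⊤ : Submodule A ↥ρ.toTopRep.ρ.invariants))) :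
    Finite (LinearMap.ker (TorsionControl.torsionInclH1 ρ r)) := by
  have hSES := TorsionControl.isSES_torsion ρ r hr
  have hker : r • (⊤ : Submodule A ↥ρ.toTopRep.ρ.invariants) ≤ LinearMap.ker hSES.δ₀ := by
    rintro x hx
    obtain ⟨w, -, rfl⟩ := (Submodule.mem_smul_pointwise_iff_exists _ _ _).mp hx
    rw [LinearMap.mem_ker, hSES.δ₀_eq_zero_iff]
    exact ⟨w.1, w.2, rfl⟩
  let δbar := (r • (⊤ : Submodule A ↥ρ.toTopRep.ρ.invariants)).liftQ hSES.δ₀ hker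
  haveI : Finite (LinearMap.range δbar) := (Set.finite_range δbar).to_subtype
  have hrange : LinearMap.range hSES.δ₀ = LinearMap.range δbar := (Submodule.range_liftQ _ _ _).symm
  have hkr : LinearMap.ker (TorsionControl.torsionInclH1 ρ r) ≤ LinearMap.range δbar := by
    intro x hx
    rw [LinearMap.mem_ker, TorsionControl.torsionInclH1_apply] at hx
    obtain ⟨v, hv⟩ := (TorsionControl.cohomologyMap_torsionIncl_eq_zero_iff ρ r hr x).1 hx
    rw [← hrange]
    exact ⟨v, hv⟩
  exact Finite.of_injective (Submodule.inclusion hkr) (Submodule.inclusion_injective hkr)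

end GlobalDefect

/-! ## §C Two-sided finite control, Selmer side -/

section TwoSided

variable {A : Type*} [CommRing A] [TopologicalSpace A]
variable {Γ : Type u} [Group Γ] [TopologicalSpace Γ] [IsTopologicalGroup Γ]
variable {M : Type u} [AddCommGroup M] [Module A M] [TopologicalSpace M] [DiscreteTopology M]
  [ContinuousSMul A M]
variable {ι : Type*} {Γv : ι → Type u} [∀ v, Group (Γv v)] [∀ v, TopologicalSpace (Γv v)]
  [∀ v, IsTopologicalGroup (Γv v)] (φ : ∀ v, Γv v →ₜ* Γ) (L : Set ι)

/-- **Two-sided finite control (Selmer side), the cell-C replacement of erratum Lemma 2.1 / [JSW17, L. 3.4.1].**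
For `r`-divisible `M`: if the GLOBAL invariants have finite `r`-cotorsion (`M^Γ ⧸ r`), the constrained local invariants
have finite `r`-cotorsion at the finitely many `v ∈ L₀` and are `r`-divisible at the other constrained `v`, then the
control map `θ_r : Sel(M[r]) → Sel(M)[r]` (restriction of `H¹(ι)`) has FINITE KERNEL (§3) and FINITE COKERNEL (tree
`SelmerFiniteDefect.finite_selmer_torsion_quot`, no global hypothesis). Neither (glob) nor (dec) of the exact case is
assumed — both fail on cell C. Intended instance: `Γ = Γ_K`, `M = M₂` the two-variable module over `Λ₂ = 𝒪₂⟦T⟧`,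
`r = X′ − x_k`, `L₀ = {𝔭̄}` (decomposition index), the inertia indices divisible (Steinberg monodromy / unramified).
[cite: JetchevSkinnerWan2017, Lemma 3.4.1 (arXiv:1512.06894 p. 14)] [cite: Castella2018Erratum, Lemma 2.1 (p. 2)] -/
theorem twoSided_finite_control (ρ : ContinuousRep Γ A M) (r : A)
    (hr : Function.Surjective fun m : M => r • m)
    (hglob : Finite (↥ρ.toTopRep.ρ.invariants ⧸ r • (⊤ : Submodule A ↥ρ.toTopRep.ρ.invariants)))
    (L₀ : Finset ι) (hL₀ : ∀ v ∈ L₀, v ∈ L)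
    (hloc : ∀ v ∈ L, v ∉ L₀ → ∀ w ∈ ((ρ.restrict (φ v)).toTopRep).ρ.invariants,
      ∃ w' ∈ ((ρ.restrict (φ v)).toTopRep).ρ.invariants, r • w' = w)
    (hfin : ∀ v ∈ L₀, Finite (QuotSMulTop r ↥(((ρ.restrict (φ v)).toTopRep).ρ.invariants))) :
    Finite ↥(LinearMap.ker ((TorsionControl.torsionInclH1 ρ r).domRestrict
        (TorsionControl.selmer φ L (TorsionControl.torsionRep ρ r)))) ∧
    Finite (↥(TorsionControl.selmer φ L ρ ⊓ Submodule.torsionBy A (continuousCohomology 1 ρ.toTopRep) r) ⧸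
      Submodule.comap (TorsionControl.selmer φ L ρ ⊓
          Submodule.torsionBy A (continuousCohomology 1 ρ.toTopRep) r).subtype
        (Submodule.map (TorsionControl.torsionInclH1 ρ r)
          (TorsionControl.selmer φ L (TorsionControl.torsionRep ρ r)))) := by
  refine ⟨?_, Theorems.ErratumThm23TwoVariable.SelmerFiniteDefect.finite_selmer_torsion_quot φ L ρ r hr L₀ hL₀
    hloc hfin⟩
  haveI := finite_ker_torsionInclH1_of_finite_quot ρ r hr hglob
  refine Finite.of_injective
    (fun x : LinearMap.ker ((TorsionControl.torsionInclH1 ρ r).domRestrict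
        (TorsionControl.selmer φ L (TorsionControl.torsionRep ρ r))) =>
      (⟨(x.1 : continuousCohomology 1 (TorsionControl.torsionRep ρ r).toTopRep), by
        have hx := x.2
        rw [LinearMap.mem_ker, LinearMap.domRestrict_apply] at hx
        exact hx⟩ : LinearMap.ker (TorsionControl.torsionInclH1 ρ r))) ?_
  intro x y hxy
  apply Subtype.ext
  apply Subtype.ext
  simpa using congrArg Subtype.val hxy

end TwoSided

end Summit.BirchSwinnertonDyer.BirchSwinnertonDyer.Theorems.TelescopeK2WeightControl

end
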